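import Literature.Barriers.ResolutionOfSingularities.SigmaMaxContainsFullEdimCurve
import Literature.AlgebraicGeometry.Hironaka2017.Proofs.S04CharAlgebra.WQSigmaMaxCurve
import Literature.AlgebraicGeometry.Hironaka2017.Proofs.S04CharAlgebra.WQSigmaMaxOff
import Literature.AlgebraicGeometry.Hironaka2017.S04CharAlgebra.R007aInv
import HarnessLib

/-!
# Barrier supplement: `SigmaMaxContainsFullEdimCurve` — the identification «`Σ_max(Inv) = T_c = {0} ∪ w-axis ∪ γ̄ ∋ P₀`» on the
# W-Q specimen, IN THE KERNEL for the algebraic `℘` (edge ideal `(x̃̄²)`, `r = 1`, `q₁ = 2`, Eq. (34) value `(5,4,2)` at EVERY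
# `K`-point of `T_c`; an ORDER-ONE element of `℘(E,1)` at every other singular `K`-point)

`Literature/Barriers/ResolutionOfSingularities/SigmaMaxContainsFullEdimCurveInv.lean` — kernel SUPPLEMENT to the catalogue entry
`SigmaMaxContainsFullEdimCurve.lean` (p490345; cell res-hironaka, D-0089; director-resolution 2026-08-27T05:44:31Z: «#3 … label
upgrade hand+kit → kernel(first blow-up); #2 still hand+kit at [claim] level»; drafter res-type-046, the entry's filer). The parent
entry PROVES that no torus-stable subset of `𝔸⁵(k)` through `P₀ = (1,1,1,1,1)` lies in a hypersurface smooth at `0`, and RECORDS as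
hand + kit (its scope caveat (b): K3.2″ hand steps H1–H4 over FACT-LIST rows + kit job j264724) the identification of the top
stratum of the manuscript's `Inv` on the specimen with `T_c = {0} ∪ w-axis ∪ γ̄ ∋ P₀`. THIS FILE puts that identification in the kernel
at the level of the cell's typed ALGEBRAIC characteristic algebra (`Hironaka2017/S04CharAlgebra.pAlgebraicRing`, the manuscript's
p.17 l.8–11 definition): see `SigmaMaxContainsFullEdimCurveInv` below and the kernel files
`Hironaka2017/Proofs/S04CharAlgebra/OddDouble{Arc,Edge}.lean` (generic engine: the odd double point),
`WQSigmaMax{Tc,P0,Curve,Off}.lean` (the specimen) over `Hironaka2017/Lib/PAlgArcWeight.lean` (arc weight bound for the integral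
closure) and `Lib/PAlgLinearTransport.lean` (linear changes of coordinates).

HONEST FRAMING. H. Hironaka, *Resolution of singularities in positive characteristics*, ms. 2017 [Hironaka2017] is an UNREFEREED
MANUSCRIPT UNDER ADJUDICATION (D-0012); its definitions (`℘`, edge data Def. 4.9, `Inv` Eq. (34), `Σ_max` / Eq. (43)) are typed by
the cell as candidates and only COMPUTED WITH here, on the cell's OWN specimen; nothing printed in the manuscript is asserted,
nothing here is a verdict on any printed sentence, nothing bears on resolution of singularities in characteristic `p`. AI proof,
weaker than expert review.

## Contents
* §1 value level (`Datum.EdgeInv 5`, Eq. (34) p.24 via row 007's `invOfExponents`): `inv542 = (5, 4, 2)`; `lt_inv542_of_q_eq_one`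
  (`(5,4,1) < (5,4,2)`), `lt_inv542_of_two_le_length` (every value with `r ≥ 2` is `< (5,4,2)`); `invmaxStratum_eq_of_pure_on` — for
  ANY `Inv`-reading `S → EdgeInv 5` taking the value `(5,4,2)` on `T ⊆ S` and a value with `q = [1]` or `r ≥ 2` off `T`, the
  `Invmax`-stratum of Eq. (43) p.30 (row 007's `invmaxStratum`) IS `T`.
* §1b `TcSet K = w-axis ∪ γ(K)`: `one_mem_TcSet` (`P₀ ∈ T_c`), `torus_mem_TcSet` (torus-stable), `TcSet_noSmoothHypersurface` — the
  PARENT entry's theorem `WQ_noSmoothHypersurfaceThroughTorusStratum` applied to `T_c(K)`: no hypersurface through `0` smooth at `0`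
  contains `T_c(K)` (infinite `K`).
* §2 `SigmaMaxContainsFullEdimCurveInv` — the headline conjunction (T) + (O) + (V) + (S).
-/

noncomputable section

namespace Literature.Barriers.ResolutionOfSingularities

open MvPolynomial Literature.AlgebraicGeometry.Hironaka2017.S04CharAlgebra
open Literature.AlgebraicGeometry.Hironaka2017.Datum (EdgeInv)

universe u

/-! ## §1 The value `(5, 4, 2)` dominates every value met off `T_c` -/

namespace SigmaMaxInv

/-- The Eq. (34) value `(n, n − r, q₁) = (5, 4, 2)`: one edge generator of exponent `q₁ = 2` in ambient dimension `5`
(row 007's packaging map `invOfExponents`). [claim: Hironaka2017, status: under-review]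
STATUS: a term of the tree's value type; nothing of the manuscript is asserted (D-0012/D-0089). -/
def inv542 : EdgeInv 5 := invOfExponents 5 [2] (by decide) (by decide)

/-- `inv542.q = [2]`. [claim: Hironaka2017, status: under-review]
[cite: Hironaka2017, Eq. (34) p.24 l.29–31 (unrefereed manuscript under adjudication — kernel fact about the tree's value type, nothing of the manuscript asserted)] -/
theorem inv542_q : inv542.q = [2] := rfl

/-- **`(5, 4, 1) < (5, 4, 2)`**: a value with exponent list `[1]` (one edge generator, linear — «`y◦ ≠ ∅`») is lexicographically
below `(5, 4, 2)`. [claim: Hironaka2017, status: under-review]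
[cite: Hironaka2017, Eq. (34) p.24 l.29–31; Th 16.6 (2) p.84 (unrefereed manuscript under adjudication — kernel fact about the tree's value type, nothing of the manuscript asserted)] -/
theorem lt_inv542_of_q_eq_one (w : EdgeInv 5) (hw : w.q = [1]) : w < inv542 := by
  rw [EdgeInv.lt_iff]
  have hle : w.key ≤ inv542.key :=
    EdgeInv.key_le_of_forall₂ inv542 w (by rw [inv542_q, hw]; exact List.Forall₂.cons (by norm_num) List.Forall₂.nil)
  refine lt_of_le_of_ne hle fun h => ?_
  have h' := congrArg EdgeInv.q (EdgeInv.key_injective h)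
  rw [hw, inv542_q] at h'
  exact absurd h' (by decide)

/-- **Every value with `r ≥ 2` is `< (5, 4, 2)`** (the entry `n − r` drops). [claim: Hironaka2017, status: under-review]
[cite: Hironaka2017, Eq. (34) p.24 l.29–31; Th 16.6 (2) p.84 (unrefereed manuscript under adjudication — kernel fact about the tree's value type, nothing of the manuscript asserted)] -/
theorem lt_inv542_of_two_le_length (w : EdgeInv 5) (hw : 2 ≤ w.q.length) : w < inv542 := by
  rw [EdgeInv.lt_iff]
  exact EdgeInv.key_lt_of_length_lt inv542 w (by rw [inv542_q]; simp; omega)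

/-- **The `Invmax`-stratum of a pure-on-`T` reading is `T`.** For ANY set of points `S`, subset `T ⊆ S` with `T` non-empty, and ANY
`Inv`-reading `f : P → EdgeInv 5` with `f ≡ (5,4,2)` on `T` and, off `T` inside `S`, `f` of exponent list `[1]` or of length `≥ 2`:
row 007's `invmaxStratum S f` (the set of Eq. (43) p.30 «`{ξ ∈ Sing(Ê)_cl | Inv_ξ(Ê) = Invmax(Ê)}`») equals `T`.
[claim: Hironaka2017, status: under-review]
[cite: Hironaka2017, Eq. (43) p.30 l.8 · Eq. (34) p.24 l.29–31 (unrefereed manuscript under adjudication — kernel fact about the tree's value type and row 007's set, nothing of the manuscript asserted)] -/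
theorem invmaxStratum_eq_of_pure_on {P : Type u} (S T : Set P) (hTS : T ⊆ S) (hT : T.Nonempty) (f : P → EdgeInv 5)
    (hon : ∀ ξ ∈ T, f ξ = inv542) (hoff : ∀ η ∈ S, η ∉ T → (f η).q = [1] ∨ 2 ≤ (f η).q.length) :
    invmaxStratum S f = T := by
  have hlt : ∀ η ∈ S, η ∉ T → f η < inv542 := fun η hη hηT => by
    rcases hoff η hη hηT with h | h
    · exact lt_inv542_of_q_eq_one _ h
    · exact lt_inv542_of_two_le_length _ h
  ext ξ
  constructor
  · rintro ⟨hξS, hmax⟩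
    by_contra hξT
    obtain ⟨ξ₀, hξ₀⟩ := hT
    have h1 : (f ξ₀).key ≤ (f ξ).key := hmax ξ₀ (hTS hξ₀)
    have h2 : (f ξ).key < (f ξ₀).key := by
      have := hlt ξ hξS hξT
      rw [EdgeInv.lt_iff, ← hon ξ₀ hξ₀] at this
      exact this
    exact lt_irrefl _ (lt_of_le_of_lt h1 h2)
  · intro hξT
    refine ⟨hTS hξT, fun η hη => ?_⟩
    show (f η).key ≤ (f ξ).key
    by_cases hηT : η ∈ T
    · rw [hon η hηT, hon ξ hξT]
    · rw [hon ξ hξT]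
      exact le_of_lt ((EdgeInv.lt_iff _ _).mp (hlt η hη hηT))

end SigmaMaxInv


/-! ## §1b The set `T_c(K)` is torus-stable and contains `P₀`: the parent entry applies to it -/

namespace SigmaMaxInv

variable (K : Type u) [Field K]

/-- `T_c(K) = w-axis ∪ γ(K) ⊂ K⁵` (the origin is `γ(0)` and lies on the axis). [claim: Hironaka2017, status: under-review]
STATUS: the cell's OWN point set on its OWN specimen (K3.2″ §4); nothing of the manuscript is asserted (D-0012/D-0089). -/
def TcSet : Set (Fin 5 → K) := {p | p = ![0, 0, 0, p 3, 0] ∨ ∃ t : K, p = ![t ^ 99, t ^ 18, t ^ 20, t ^ 24, t ^ 29]}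

/-- `P₀ = (1,1,1,1,1) = γ(1) ∈ T_c(K)`. [claim: Hironaka2017, status: under-review]
[cite: Hironaka2017, Eq. (43) p.30 l.8 (unrefereed manuscript under adjudication — kernel fact about the cell's own point set, nothing of the manuscript asserted)] -/
theorem one_mem_TcSet : (fun _ => (1 : K)) ∈ TcSet K := by
  refine Or.inr ⟨1, ?_⟩
  funext i
  fin_cases i <;> simp

/-- **`T_c(K)` is stable under the torus `λ·(x,y,z,w,v) = (λ⁹⁹x, λ¹⁸y, λ²⁰z, λ²⁴w, λ²⁹v)`** (`γ(t) ↦ γ(λt)`, the axis to itself).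
[claim: Hironaka2017, status: under-review]
[cite: Hironaka2017, Eq. (43) p.30 l.8 (unrefereed manuscript under adjudication — kernel fact about the cell's own point set, nothing of the manuscript asserted)] -/
theorem torus_mem_TcSet (c : K) {P : Fin 5 → K} (hP : P ∈ TcSet K) : FullEdimCurve.torus K WQSigmaMax.wqExp c P ∈ TcSet K := by
  rcases hP with h | ⟨t, h⟩
  · refine Or.inl ?_
    rw [h]
    funext i
    fin_cases i <;> simp [FullEdimCurve.torus, WQSigmaMax.wqExp]
  · refine Or.inr ⟨c * t, ?_⟩
    rw [h]
    funext i
    fin_cases i <;> simp [FullEdimCurve.torus, WQSigmaMax.wqExp, mul_pow]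

/-- **The parent entry applied to `T_c(K)`**: over an infinite field of characteristic `2`, NO hypersurface `F = 0` through the origin
that is smooth there contains `T_c(K)` (= `Σ_max(Inv)(K)` by the headline below, for any manuscript-style reading) — it contains the
curve `γ` of embedding dimension `5` at `0` (`WQ_noSmoothHypersurfaceThroughTorusStratum`). [cite: Kollar2007, Aside 3.57] -/
theorem TcSet_noSmoothHypersurface [CharP K 2] [Infinite K] :
    ¬ ∃ F : MvPolynomial (Fin 5) K, IsSmoothAtOrigin F ∧ ∀ P ∈ TcSet K, eval P F = 0 :=
  WQ_noSmoothHypersurfaceThroughTorusStratum K (TcSet K) (fun c _ _ hP => torus_mem_TcSet K c hP) (one_mem_TcSet K)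

end SigmaMaxInv

/-! ## §2 The headline -/

open SigmaMaxInv WQTc in
/-- **`SigmaMaxContainsFullEdimCurveInv` — KERNEL SUPPLEMENT to the barrier entry `SigmaMaxContainsFullEdimCurve` (p490345): the
identification «`Σ_max(Inv) = T_c = {0} ∪ w-axis ∪ γ̄ ∋ P₀`» on the W-Q specimen `E = (fW, 2) ⊂ 𝔸⁵`, characteristic `2`, at the
level of the ALGEBRAIC characteristic algebra.**

The entry's scope caveat (b) marks as HAND + kit (K3.2″ report §2–§4, hand steps H1–H4 over FACT-LIST rows, kit job j264724, local
certificates p485247/p485262) the statement that the top stratum of the manuscript's `Inv` of Eq. (34) p.24 on the specimen is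
`T_c = {0} ∪ w-axis ∪ γ̄`, `γ(t) = (t⁹⁹, t¹⁸, t²⁰, t²⁴, t²⁹)`, `P₀ = γ(1)`. THIS THEOREM is that statement in the kernel for OUR typed
ALGEBRAIC `℘` (`S04CharAlgebra.pAlgebraicRing`, the manuscript's algebraic definition p.17 l.8–11 typed by row 003; its agreement with
the geometric `℘` is the manuscript's import from [23], Th. 4.4 / U17_4, and is NOT used or asserted here), for EVERY field `K` of
characteristic `2` and ALL `K`-points (no perfectness, no algebraic closure). With `f_p = fW(X + p)` the witness re-centred at the
`K`-point `p` and `℘alg(E_p, a)` the degree-`a` piece of the algebraic `℘` of `((f_p), 2)`: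
* (T) ON `T_c` — at the origin (`WQTc.origin_hupLift`, odd double point with `d = 7`), at every `(0,0,0,c,0)`, `c ≠ 0`
  (`wAxis_hupLift`, `d = 3`; no `√c` needed), and at every `γ(t)`, `t ≠ 0` (`curve_hupLift`, `d = 3` after the tilt
  `x̃_t = x + t⁸¹y + t⁷⁵w + t⁷⁰v`, transported by the linear automorphism `β_t`): (i) `℘alg(E_p, a) ⊆ 𝔪_p^a`; (ii) for `a ≥ 1` the
  degree-`a` initial form of EVERY element of `℘alg(E_p, a)` is divisible by `x̃̄²` (`x̃ = x` on the axis and at `0`); (ii′)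
  `℘alg(E_p, 1) ⊆ 𝔪_p²` — NO element of order `1`; (iii) `f_p ∈ ℘alg(E_p, 2)` with `f_p − x̃² ∈ 𝔪_p³`: the form `x̃̄²` is attained.
  Hence (Def. 4.9 p.20 l.31–35; the cell's kernel pattern `hup + lift identity ⇒ exists_isEdgeData_pure`,
  `Hironaka2017/Proofs/S16Proof/InvSlotSingAlign`): edge ideal `(x̃̄²)`, ONE generator, `r = 1`, `q₁ = 2`, Eq. (34) value `(5, 4, 2)` at
  every `K`-point of `T_c`.
* (O) OFF `T_c` (`WQTc.exists_order_one_off_Tc`) — at every `K`-point `p` of `Sing(E)` (`fW(p) = 0`, `∇fW(p) = 0`) that is not on the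
  `w`-axis and not of the form `γ(t)`, some partial `∂_j f_p` — an element of `℘alg(E_p, 1)` as a `Diff^{(1)}` generator — has ORDER
  EXACTLY ONE (`∉ 𝔪_p²`): `y◦ ≠ ∅` in Def. 4.11 p.21, the edge ideal contains a linear form, so the Eq. (34) value has `q₁ = 1`
  (`(5,4,1)`) or `r ≥ 2`. Ingredient (`mem_Tc_of_hessian_eq_zero`, field algebra): the `K`-points of `V(fW, ∂_y fW, ∂_w fW,
  ∂_z∂_y fW, ∂_w∂_y fW, ∂_w∂_z fW)` are EXACTLY the `w`-axis and `γ(K)`.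
* (V) VALUE LEVEL (`Datum.EdgeInv 5`, row 007): `(5,4,1) < (5,4,2)` and every value with `r ≥ 2` is `< (5,4,2)`
  (`lt_inv542_of_q_eq_one`, `lt_inv542_of_two_le_length`); consequently for ANY `Inv`-reading on any point set `S ⊇ T ≠ ∅` that is
  `(5,4,2)` on `T` and has `q = [1]` or `r ≥ 2` off `T`, row 007's `invmaxStratum S Inv` (Eq. (43) p.30) IS `T`
  (`invmaxStratum_eq_of_pure_on`).
* (S) STRUCTURAL: `T_c(K)` (`SigmaMaxInv.TcSet`) contains `P₀ = (1,1,1,1,1)` and is stable under the torus of weights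
  `(99,18,20,24,29)`, so the PARENT entry's `WQ_noSmoothHypersurfaceThroughTorusStratum` applies to it: over an infinite field of
  characteristic `2` no hypersurface through `0` smooth at `0` contains `T_c(K)`.
So, GIVEN the manuscript-style reading of Eq. (34) on these edge data (pure `(x̃̄²)` ↦ `(5,4,2)`; an order-one element ↦ `q₁ = 1` or
`r ≥ 2`), `Σ_max(Inv)(K) = T_c(K) ∋ P₀` — the input «`P₀ ∈ Σ_max`» of the parent entry's application, formerly its hand + kit half —
and `Σ̄_max` lies in no regular hypersurface germ at `0`.
NOT covered here (still as recorded in the parent entry / the cell's ledger): the passage algebraic `℘` ↔ geometric `℘` ([23], U17_4)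
and to stalks (locality of edge data), the closed-point bookkeeping over non-closed fields beyond `K`-points, anything about later
blow-ups. Nothing here is a claim about resolution of singularities in characteristic `p`, nor a verdict on any printed sentence
(D-0012/D-0089). [claim: Hironaka2017, status: under-review]
[cite: Hironaka2017, Rem. 4.7 / Def. 4.9 p.20 l.13–35 · Def. 4.11 p.21 · Eq. (34) p.24 l.29–31 · Eq. (43) p.30 l.8 · §4 p.17 l.8–11 (unrefereed manuscript under adjudication — kernel computation of OUR typed algebraic ℘ at the cell's specimen, nothing of the manuscript asserted)]

BARRIER (D-0021) — ADDENDUM to `SigmaMaxContainsFullEdimCurve` (same entry; this file upgrades its scope caveat (b)):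
- technique_class: canonical-strata regular-cut-as-focus top-locus-as-centre intrinsic-stratification sigma-max embedding-dimension torus-orbit maximal-contact-containment edge-data characteristic-algebra positive-characteristic
- blocks: as the parent entry; sharpened: on the W-Q specimen the manuscript-style edge datum (Def. 4.9 / Eq. (34), computed for the typed ALGEBRAIC `℘`) is the pure `(x̃̄²)`, value `(5,4,2)`, at EVERY `K`-point of `T_c = {0} ∪ w-axis ∪ γ̄` and admits an ORDER-ONE element at every other singular `K`-point — so any `Inv`-reading with the two properties above has `Σ_max = T_c ∋ P₀`, and the parent entry's ∀-statement applies to `Σ̄_max` itself: it contains `γ̄` of embedding dimension `5` at `0` and lies in no regular hypersurface germ there [claim: Hironaka2017, status: under-review] (the definitions are the manuscript's, typed by the cell; the computation is OURS and kernel-checked here).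
- because: at each point of `T_c` the re-centred `fW` is an ODD DOUBLE POINT `x̃² + Q(u)`, `ord Q = d` odd (`7` at `0`, `3` elsewhere), `Q_d ≠ 0` (`w̄v̄⁶`, `c⁵z̄v̄²`, `z̄w̄²+z̄³+ȳz̄w̄+ȳ³`); the square-root arc `x̃ ↦ t^d r(t)`, `u ↦ δt²` through the generic direction lies on the hypersurface (Frobenius), `∂f ∈ 𝔪^{d−1}` has weight `2(d−1)`, the arc weight bound for the integral closure (`Lib/PAlgArcWeight`) gives `t^{2(d−1)a} ∣ Ψ(g)` on `℘alg(E,a)`, and the coefficients of weights `2a` and `2(a−1)+d` (odd `d`: no collision) are the `x̃̄`-free and `x̃̄`-linear parts of `in_a(g)` at the generic point (`OddDouble.oddDouble_hupLift`); the torus curve is reached from `P₀` by the LINEAR automorphism `β_t` (`WQTc.β_fγ`, `Lib/PAlgLinearTransport`); off `T_c` the three mixed second partials `z²(w⁵+z⁶)`, `z²(v⁴+zw⁴)`, `w⁴(v²+yz²)` cannot all vanish unless `z = 0` (axis) or `t := vz/w²` parametrises the point (`WQTc.axis_or_curve_of_relations`), and a non-vanishing one makes `∂_j f_p ∈ ℘alg(E,1)`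 of order `1` (`WQTc.pderiv_fAt_not_mem_sq`).
- evasions_known: as the parent entry ((i) refine by embedding dimension; (ii) non-faithful stratifiers / weak maximal contact / projections; (iii) avoid maximal-contact containment; (iv) blow up first — with the K3.5 caveat); nothing new.
- scope_caveats: (a) PROVED here: parent scope (b)'s identification «`Σ_max(Inv) ∩ K`-points `= T_c(K)`» in the form (T) + (O) + (V) above, for the ALGEBRAIC `℘` of the manuscript's p.17 definition as typed by row 003 (`pAlgebraicRing` over the polynomial ring of `𝔸⁵`, re-centred at each `K`-point), every field `K` of characteristic `2`, all `K`-points; (b) NOT covered: the passage algebraic `℘` ↔ geometric `℘` (the manuscript's import from [23], U17_4) and to stalks / the scheme-level edge datum of row 005 (`EdgeDatum` / `IsEdgeData` at `O_{Z,ξ}`) — the reading «pure `(x̃̄²)` ↦ `(5,4,2)`, order-one element ↦ `q₁ = 1 ∨ r ≥ 2`» is the cell's pattern `InvSlotSingAlign.exists_isEdgeData_pure` / Def. 4.11 and is stated, not re-derived, here; non-`K`-rational closed points; (c) the companion W2′ (`char 3`) is not treated; (d) nothing here bears on the EXISTENCE of resolutions in characteristic `p`.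
- status: established (kernel-checked: `T_c` ∪ its complement in `Sing(E)`, all `K`-points, every field of characteristic `2`, algebraic `℘`) -/
theorem SigmaMaxContainsFullEdimCurveInv :
    (∀ (K : Type u) [Field K] [CharP K 2],
      -- (T) on `T_c`: origin
      ((∀ a : ℕ, OddDouble.PQ K (WQTc.GW K) a ≤ WQExc.𝔪 K ^ a) ∧
        (∀ a : ℕ, 1 ≤ a → ∀ g ∈ OddDouble.PQ K (WQTc.GW K) a, (X 0 : WQExc.O K) ^ 2 ∣ homogeneousComponent a g) ∧
        OddDouble.PQ K (WQTc.GW K) 1 ≤ WQExc.𝔪 K ^ 2 ∧ OddDouble.fQ K (WQTc.GW K) ∈ OddDouble.PQ K (WQTc.GW K) 2 ∧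
        OddDouble.fQ K (WQTc.GW K) - X 0 ^ 2 ∈ WQExc.𝔪 K ^ 7) ∧
      -- (T) punctured `w`-axis
      (∀ c : K, c ≠ 0 →
        (∀ a : ℕ, OddDouble.PQ K (WQTc.Qw K c) a ≤ WQExc.𝔪 K ^ a) ∧
        (∀ a : ℕ, 1 ≤ a → ∀ g ∈ OddDouble.PQ K (WQTc.Qw K c) a, (X 0 : WQExc.O K) ^ 2 ∣ homogeneousComponent a g) ∧
        OddDouble.PQ K (WQTc.Qw K c) 1 ≤ WQExc.𝔪 K ^ 2 ∧ OddDouble.fQ K (WQTc.Qw K c) ∈ OddDouble.PQ K (WQTc.Qw K c) 2 ∧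
        OddDouble.fQ K (WQTc.Qw K c) - X 0 ^ 2 ∈ WQExc.𝔪 K ^ 3) ∧
      -- (T) punctured torus curve
      (∀ t : K, t ≠ 0 →
        (∀ a : ℕ, WQTc.Pγ K t a ≤ WQExc.𝔪 K ^ a) ∧
        (∀ a : ℕ, 1 ≤ a → ∀ g ∈ WQTc.Pγ K t a, WQTc.xTilde K t ^ 2 ∣ homogeneousComponent a g) ∧
        WQTc.Pγ K t 1 ≤ WQExc.𝔪 K ^ 2 ∧ WQTc.fγ K t ∈ WQTc.Pγ K t 2 ∧ WQTc.fγ K t - WQTc.xTilde K t ^ 2 ∈ WQExc.𝔪 K ^ 3) ∧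
      -- (O) off `T_c`
      (∀ p : Fin 5 → K, eval p (Literature.AlgebraicGeometry.Hironaka2017.WQWitness.fW (R := K)) = 0 →
        (∀ i, eval p (pderiv i (Literature.AlgebraicGeometry.Hironaka2017.WQWitness.fW (R := K))) = 0) →
        p ≠ ![0, 0, 0, p 3, 0] → (∀ t : K, p ≠ ![t ^ 99, t ^ 18, t ^ 20, t ^ 24, t ^ 29]) →
        ∃ j : Fin 5, pderiv j (WQTc.fAt K p) ∈ WQTc.PAt K p 1 ∧ pderiv j (WQTc.fAt K p) ∉ WQExc.𝔪 K ^ 2)) ∧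
    -- (V) value level
    (∀ w : EdgeInv 5, w.q = [1] → w < SigmaMaxInv.inv542) ∧
    (∀ w : EdgeInv 5, 2 ≤ w.q.length → w < SigmaMaxInv.inv542) ∧
    (∀ (P : Type u) (S T : Set P), T ⊆ S → T.Nonempty → ∀ f : P → EdgeInv 5,
      (∀ ξ ∈ T, f ξ = SigmaMaxInv.inv542) → (∀ η ∈ S, η ∉ T → (f η).q = [1] ∨ 2 ≤ (f η).q.length) →
      invmaxStratum S f = T) ∧
    -- (S) structural: `T_c(K)` is torus-stable through `P₀`, so the parent entry applies to it
    (∀ (K : Type u) [Field K] [CharP K 2] [Infinite K],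
      (fun _ => (1 : K)) ∈ SigmaMaxInv.TcSet K ∧
      (∀ c : K, c ≠ 0 → ∀ P ∈ SigmaMaxInv.TcSet K, FullEdimCurve.torus K WQSigmaMax.wqExp c P ∈ SigmaMaxInv.TcSet K) ∧
      ¬ ∃ F : MvPolynomial (Fin 5) K, IsSmoothAtOrigin F ∧ ∀ P ∈ SigmaMaxInv.TcSet K, eval P F = 0) := by
  refine ⟨fun K _ _ => ⟨?_, fun c hc => WQTc.wAxis_hupLift K hc, fun t ht => WQTc.curve_hupLift K ht,
    fun p h0 hs ha hc => WQTc.exists_order_one_off_Tc K p h0 hs ha hc⟩, lt_inv542_of_q_eq_one, lt_inv542_of_two_le_length,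
    fun P S T hTS hT f hon hoff => invmaxStratum_eq_of_pure_on S T hTS hT f hon hoff,
    fun K _ _ _ => ⟨one_mem_TcSet K, fun c _ P hP => torus_mem_TcSet K c hP, TcSet_noSmoothHypersurface K⟩⟩
  exact WQTc.origin_hupLift K

end Literature.Barriers.ResolutionOfSingularities

end
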